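import Literature.NumberTheory.EllipticCurves.KodairaNeronSplitHenselianProofs
import HarnessLib

/-!
# Sums of bad points on the Tate normal form `y² + xy = x³ + απⁿ` via the product formula

Topic `NumberTheory/EllipticCurves` (family `abc`, G06; also `bsd`). Pure proofs, no definitions
and no named facts. First of two files (`TateNormalFormComponents.lean` is the second) proving
the group structure `J(K)/J₀(K) ≅ ℤ/nℤ` with labelled components for the Tate normal form
`J : y² + xy = x³ + απⁿ` (`α ∈ Rˣ`, `π` a uniformiser, `n ≥ 1`) over a discrete valuation ring
`R` with fraction field `K` (Silverman, *ATAEC*, Cor. IV.9.2(d): for split multiplicative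
reduction "`E(K)/E₀(K)` is a cyclic group of order `v(Δ) = −v(j)`"; components labelled by
`v(u) mod v(q)` under Tate's parametrisation, V.4, Lemma 4.1.2). Bad points have a *shape*
(`LocalIndex.shape_of_bad`): level `i` and branch `0` (`(πⁱu, πⁱut)`, `t ∈ 𝔪`), level `i` and
branch `−1` (`t + 1 ∈ 𝔪`), or middle (`(πʰx', πʰy')`, `n = 2h`). This file proves:

* `sub_mem_of_low`, `sub_mem_of_middle`: two bad points of the same shape and level are
  congruent modulo `J₀(K)` (from `add_low`, `add_middle` of
  `NeronComponentIndexSplitPoints.lean` and the negation `−(x, y) = (x, −y − x)`);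
* `add_eq_of_slope_eq`, `shape_add_of_slope_eq`: **the sum of two bad points through a line of
  slope `λ ∈ 𝔪`** with intercept `ν = y₁ − λx₁ = πᵐ·unit` and `x₁x₂ = πᵐ·unit` is computed from
  the constant term of the chord cubic, `x₁x₂x₃ = ν² − a₆` (`X_mul_X_mul_addX_slope`) — no
  cancellation occurs there, unlike in `x₃ = λ² + λ − x₁ − x₂` — and is a low point of level `m`
  and branch `0` if `2m < n` (the branch because `ν/x₃` is a unit), a middle point if `2m = n`.
  This is the additivity of `v(u)` on `K*/q^ℤ` seen on the equation.

## References

* J. H. Silverman, *Advanced Topics in the Arithmetic of Elliptic Curves*, GTM 151, Springer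
  1994: Cor. IV.9.2(d) (PDF p. 340), V.4, Prop. 4.1 and Lemmas 4.1.1–4.1.4 (PDF pp. 402–405).
  [SilvermanATAEC1994]
-/

noncomputable section

open scoped Classical

open IsLocalRing

namespace Literature.NumberTheory.EllipticCurves

namespace LocalIndex

open DiophantineGeometry DiophantineGeometry.TateAlgorithm

variable {R : Type*} [CommRing R] [IsDomain R] [IsDiscreteValuationRing R]
  {K : Type*} [Field K] [Algebra R K] [IsFractionRing R K]

section TateNormalForm

variable (J : WeierstrassCurve R) {ϖ : R} {α : R} {n : ℕ}

/-! ### Negation and congruences of bad points of the same shape -/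

omit [IsDomain R] [IsDiscreteValuationRing R] [IsFractionRing R K] in
/-- Negation in coordinates on `y² + xy = x³ + a₆`: `−(x, y) = (x, −y − x)`. [folklore] -/
theorem neg_some_of_tateNormalForm (h1 : J.a₁ = 1) (h3 : J.a₃ = 0) {x y : R}
    (h : (J.baseChange K).toAffine.Nonsingular (algebraMap R K x) (algebraMap R K y)) :
    ∃ h', -WeierstrassCurve.Affine.Point.some _ _ h =
      WeierstrassCurve.Affine.Point.some (algebraMap R K x) (algebraMap R K (-y - x)) h' := by
  have hnegY : (J.baseChange K).toAffine.negY (algebraMap R K x) (algebraMap R K y) =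
      algebraMap R K (-y - x) := by
    rw [WeierstrassCurve.Affine.negY]
    simp only [WeierstrassCurve.baseChange, WeierstrassCurve.map_a₁, WeierstrassCurve.map_a₃, h1,
      h3, map_one, map_zero, map_sub, map_neg]; ring
  refine ⟨hnegY ▸ (WeierstrassCurve.Affine.nonsingular_neg _ _).mpr h, ?_⟩
  rw [WeierstrassCurve.Affine.Point.neg_some]
  exact point_some_congr rfl hnegY

omit [IsDomain R] [IsDiscreteValuationRing R] [IsFractionRing R K] in
/-- The negative of a low point `(πⁱu, πⁱut)` is the low point `(πⁱu, πⁱu(−t − 1))` of the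
other branch. [folklore] -/
theorem neg_low_of_tateNormalForm (h1 : J.a₁ = 1) (h3 : J.a₃ = 0) {i : ℕ} {u t : R}
    (h : (J.baseChange K).toAffine.Nonsingular (algebraMap R K (ϖ ^ i * u))
      (algebraMap R K (ϖ ^ i * u * t))) :
    ∃ h', -WeierstrassCurve.Affine.Point.some _ _ h =
      WeierstrassCurve.Affine.Point.some (algebraMap R K (ϖ ^ i * u))
        (algebraMap R K (ϖ ^ i * u * (-t - 1))) h' := by
  obtain ⟨h', e⟩ := neg_some_of_tateNormalForm J h1 h3 h
  have hy : -(ϖ ^ i * u * t) - ϖ ^ i * u = ϖ ^ i * u * (-t - 1) := by ring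
  refine ⟨(congrArg (algebraMap R K) hy) ▸ h', ?_⟩
  rw [e]
  exact point_some_congr rfl (congrArg (algebraMap R K) hy)

/-- **Two low points of the same level and branch are congruent modulo `E₀(K)`** (from
`add_low` applied to `P + (−P')`). [folklore] -/
theorem sub_mem_of_low (hϖ : Irreducible ϖ) (h1 : J.a₁ = 1) (h2 : J.a₂ = 0) (h3 : J.a₃ = 0)
    (h4 : J.a₄ = 0) (h6 : J.a₆ ∈ maximalIdeal R) {i : ℕ} (hi : 1 ≤ i) {u u' t t' : R}
    (hu : IsUnit u) (hu' : IsUnit u')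
    (ht : (t ∈ maximalIdeal R ∧ t' ∈ maximalIdeal R) ∨
      (t + 1 ∈ maximalIdeal R ∧ t' + 1 ∈ maximalIdeal R))
    (h : (J.baseChange K).toAffine.Nonsingular (algebraMap R K (ϖ ^ i * u))
      (algebraMap R K (ϖ ^ i * u * t)))
    (h' : (J.baseChange K).toAffine.Nonsingular (algebraMap R K (ϖ ^ i * u'))
      (algebraMap R K (ϖ ^ i * u' * t'))) :
    J.HasNonsingularReduction
      (WeierstrassCurve.Affine.Point.some _ _ h - WeierstrassCurve.Affine.Point.some _ _ h') := by
  rcases ht with ⟨ht, ht'⟩ | ⟨ht, ht'⟩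
  · obtain ⟨h'', e⟩ := neg_low_of_tateNormalForm J h1 h3 h'
    rw [sub_eq_add_neg, e]
    refine add_low J hϖ h1 h2 h3 h4 h6 hi hu hu' ht ?_ h h''
    have := (maximalIdeal R).neg_mem ht'; convert this using 1; ring
  · obtain ⟨h'', e⟩ := neg_low_of_tateNormalForm J h1 h3 h
    have hmem : -WeierstrassCurve.Affine.Point.some _ _ h +
        WeierstrassCurve.Affine.Point.some _ _ h' ∈
        J.nonsingularReductionSubgroup (integers_valuationRing_valuation R K) := by
      rw [e, WeierstrassCurve.mem_nonsingularReductionSubgroup_iff]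
      refine add_low J hϖ h1 h2 h3 h4 h6 hi hu hu' ?_ ht' h'' h'
      have := (maximalIdeal R).neg_mem ht; convert this using 1; ring
    have := (J.nonsingularReductionSubgroup (integers_valuationRing_valuation R K)).neg_mem hmem
    rw [show -(-WeierstrassCurve.Affine.Point.some _ _ h +
        WeierstrassCurve.Affine.Point.some _ _ h') =
        WeierstrassCurve.Affine.Point.some _ _ h - WeierstrassCurve.Affine.Point.some _ _ h'
      by abel] at this
    exact this

/-- **Two middle points are congruent modulo `E₀(K)`** (from `add_middle` applied to
`P + (−P')`; `−P' = (πʰx', πʰ(−y' − x'))` has `−ȳ' − x̄' ≠ 0` because `ȳ'(ȳ' + x̄') = ᾱ ≠ 0`);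
here a middle point is any `R`-point of the form `(πʰx', πʰy')`, `n = 2h`. [folklore] -/
theorem sub_mem_of_middle (hϖ : Irreducible ϖ) (h1 : J.a₁ = 1) (h2 : J.a₂ = 0) (h3 : J.a₃ = 0)
    (h4 : J.a₄ = 0) (hα : IsUnit α) {hh : ℕ} (hh1 : 1 ≤ hh) (h6 : J.a₆ = α * ϖ ^ (2 * hh))
    {x₁ y₁ x₁' y₁' : R}
    (h : (J.baseChange K).toAffine.Nonsingular (algebraMap R K (ϖ ^ hh * x₁))
      (algebraMap R K (ϖ ^ hh * y₁)))
    (h' : (J.baseChange K).toAffine.Nonsingular (algebraMap R K (ϖ ^ hh * x₁'))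
      (algebraMap R K (ϖ ^ hh * y₁'))) :
    J.HasNonsingularReduction
      (WeierstrassCurve.Affine.Point.some _ _ h - WeierstrassCurve.Affine.Point.some _ _ h') := by
  have hinj := IsFractionRing.injective R K
  have hϖ0 : ϖ ≠ 0 := hϖ.ne_zero
  have hm : ϖ ∈ maximalIdeal R := (IsLocalRing.mem_maximalIdeal _).mpr hϖ.not_isUnit
  have hres0 : residue R (ϖ ^ hh) = 0 :=
    (residue_eq_zero_iff _).mpr (Ideal.pow_mem_of_mem _ hm _ hh1)
  have hunit : IsUnit (-y₁' - x₁') := by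
    have he : J.toAffine.Equation (ϖ ^ hh * x₁') (ϖ ^ hh * y₁') :=
      (WeierstrassCurve.Affine.map_equation _ hinj _ _).mp h'.left
    rw [WeierstrassCurve.Affine.equation_iff, h1, h2, h3, h4, h6] at he
    have he' : y₁' ^ 2 + x₁' * y₁' = ϖ ^ hh * x₁' ^ 3 + α := mul_left_cancel₀
      (pow_ne_zero (2 * hh) hϖ0) (by rw [pow_mul]; linear_combination he)
    have hr := congrArg (residue R) he'
    simp only [map_add, map_pow, map_mul, hres0, zero_mul, zero_add] at hr
    rw [isUnit_iff_residue_ne_zero, map_sub, map_neg]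
    intro h0
    have hy0 : residue R y₁' * (residue R y₁' + residue R x₁') = residue R α := by
      linear_combination hr
    rw [show residue R y₁' + residue R x₁' = 0 by linear_combination -h0, mul_zero] at hy0
    exact (isUnit_iff_residue_ne_zero α).mp hα hy0.symm
  obtain ⟨h'', e⟩ := neg_some_of_tateNormalForm J h1 h3 h'
  have hy : -(ϖ ^ hh * y₁') - ϖ ^ hh * x₁' = ϖ ^ hh * (-y₁' - x₁') := by ring
  have e' : -WeierstrassCurve.Affine.Point.some _ _ h' =
      WeierstrassCurve.Affine.Point.some (algebraMap R K (ϖ ^ hh * x₁'))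
        (algebraMap R K (ϖ ^ hh * (-y₁' - x₁'))) ((congrArg (algebraMap R K) hy) ▸ h'') := by
    rw [e]; exact point_some_congr rfl (congrArg (algebraMap R K) hy)
  rw [sub_eq_add_neg, e']
  exact add_middle J hϖ h1 h2 h3 h4 hα hh1 h6 hunit h _

/-! ### The sum of two bad points through a line of slope `λ ∈ 𝔪`: the product formula -/

/-- **Coordinates of a chord/tangent sum via the constant term of the chord cubic.** On
`J : y² + xy = x³ + απⁿ`, let `P₁ = (x₁, y₁)`, `P₂ = (x₂, y₂)` be `R`-points with `P₁ ≠ −P₂`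
whose chord (tangent if `P₁ = P₂`) has slope `λ ∈ R`, and write the intercept as
`ν = y₁ − λx₁ = πᵐw` and `x₁x₂ = πᵐe` with `w, e ∈ Rˣ`, `2m ≤ n`. Then
`x₁x₂x₃ = ν² − a₆` (`X_mul_X_mul_addX_slope`) gives `P₁ + P₂ = (πᵐx₃, −πᵐ(λx₃ + w + x₃))`
with `e·x₃ = w² − απ^{n−2m}` (the third intersection point is `(πᵐx₃, πᵐ(λx₃ + w))`).
[folklore] -/
theorem add_eq_of_slope_eq (h1 : J.a₁ = 1) (h3 : J.a₃ = 0) (h6 : J.a₆ = α * ϖ ^ n)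
    (hϖ0 : ϖ ≠ 0) {x₁ y₁ x₂ y₂ ℓ w e : R} {m : ℕ} (h2m : 2 * m ≤ n) (he : IsUnit e)
    (hν : y₁ - ℓ * x₁ = ϖ ^ m * w) (hx : x₁ * x₂ = ϖ ^ m * e)
    (h₁ : (J.baseChange K).toAffine.Nonsingular (algebraMap R K x₁) (algebraMap R K y₁))
    (h₂ : (J.baseChange K).toAffine.Nonsingular (algebraMap R K x₂) (algebraMap R K y₂))
    (hxy : ¬(algebraMap R K x₁ = algebraMap R K x₂ ∧ algebraMap R K y₁ =
      (J.baseChange K).toAffine.negY (algebraMap R K x₂) (algebraMap R K y₂)))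
    (hslope : (J.baseChange K).toAffine.slope (algebraMap R K x₁) (algebraMap R K x₂)
      (algebraMap R K y₁) (algebraMap R K y₂) = algebraMap R K ℓ) :
    ∃ (x₃ : R) (h : (J.baseChange K).toAffine.Nonsingular (algebraMap R K (ϖ ^ m * x₃))
        (algebraMap R K (-(ϖ ^ m * (ℓ * x₃ + w + x₃))))),
      e * x₃ = w ^ 2 - α * ϖ ^ (n - 2 * m) ∧
      WeierstrassCurve.Affine.Point.some _ _ h₁ + WeierstrassCurve.Affine.Point.some _ _ h₂ =
        WeierstrassCurve.Affine.Point.some _ _ h := by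
  have hinj := IsFractionRing.injective R K
  set f := algebraMap R K with hf
  set x₃ : R := ↑he.unit⁻¹ * (w ^ 2 - α * ϖ ^ (n - 2 * m)) with hx₃
  have hex₃ : e * x₃ = w ^ 2 - α * ϖ ^ (n - 2 * m) := by
    rw [hx₃, ← mul_assoc, IsUnit.mul_val_inv, one_mul]
  -- the product formula
  have hprod := WeierstrassCurve.Affine.X_mul_X_mul_addX_slope (J.baseChange K).toAffine
    h₁.1 h₂.1 hxy
  rw [hslope] at hprod
  have ha₃ : (J.baseChange K).toAffine.a₃ = 0 := by
    simp [WeierstrassCurve.baseChange, h3]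
  have ha₆ : (J.baseChange K).toAffine.a₆ = f (α * ϖ ^ n) := by
    simp [WeierstrassCurve.baseChange, h6, hf]
  rw [ha₃, ha₆, zero_mul, add_zero] at hprod
  have hX : (J.baseChange K).toAffine.addX (f x₁) (f x₂) (f ℓ) = f (ϖ ^ m * x₃) := by
    have hne : f (ϖ ^ m * e) ≠ 0 :=
      (map_ne_zero_iff _ hinj).mpr (mul_ne_zero (pow_ne_zero _ hϖ0) he.ne_zero)
    refine mul_left_cancel₀ hne ?_
    obtain ⟨d, hd⟩ : ∃ d, n = 2 * m + d := ⟨n - 2 * m, by omega⟩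
    have hd' : n - 2 * m = d := by omega
    calc f (ϖ ^ m * e) * (J.baseChange K).toAffine.addX (f x₁) (f x₂) (f ℓ)
        = f x₁ * f x₂ * (J.baseChange K).toAffine.addX (f x₁) (f x₂) (f ℓ) := by
          rw [← map_mul, ← hx]
      _ = (f y₁ - f ℓ * f x₁) ^ 2 - f (α * ϖ ^ n) := hprod
      _ = f ((y₁ - ℓ * x₁) ^ 2 - α * ϖ ^ n) := by simp only [map_sub, map_mul, map_pow]
      _ = f (ϖ ^ m * e) * f (ϖ ^ m * x₃) := by
          rw [← map_mul, hν, hd, hx₃, hd']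
          congr 1
          have : ϖ ^ m * e * (ϖ ^ m * (↑he.unit⁻¹ * (w ^ 2 - α * ϖ ^ d))) =
              ϖ ^ m * ϖ ^ m * (e * ↑he.unit⁻¹) * (w ^ 2 - α * ϖ ^ d) := by ring
          rw [this, IsUnit.mul_val_inv, pow_add, pow_mul]
          ring
  have ha₁ : (J.baseChange K).toAffine.a₁ = 1 := by
    simp [WeierstrassCurve.baseChange, h1]
  have hY : (J.baseChange K).toAffine.addY (f x₁) (f x₂) (f y₁) (f ℓ) =
      f (-(ϖ ^ m * (ℓ * x₃ + w + x₃))) := by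
    rw [WeierstrassCurve.Affine.addY, WeierstrassCurve.Affine.negAddY, hX,
      WeierstrassCurve.Affine.negY, ha₁, ha₃]
    have key : -(ℓ * (ϖ ^ m * x₃ - x₁) + y₁) - 1 * (ϖ ^ m * x₃) - 0 =
        -(ϖ ^ m * (ℓ * x₃ + w + x₃)) := by linear_combination -hν
    have key' := congrArg f key
    simp only [map_sub, map_neg, map_add, map_mul, map_one, map_zero] at key' ⊢
    linear_combination key'
  have hns : (J.baseChange K).toAffine.Nonsingular (f (ϖ ^ m * x₃))
      (f (-(ϖ ^ m * (ℓ * x₃ + w + x₃)))) := by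
    have := WeierstrassCurve.Affine.nonsingular_add h₁ h₂ hxy
    rwa [hslope, hX, hY] at this
  rw [WeierstrassCurve.Affine.Point.add_some hxy]
  exact ⟨x₃, hns, hex₃, point_some_congr (hslope ▸ hX) (hslope ▸ hY)⟩


/-- In a local ring, a unit plus an element of the maximal ideal is a unit. [folklore] -/
theorem isUnit_add_of_isUnit_of_mem {S : Type*} [CommRing S] [IsLocalRing S] {w a : S}
    (hw : IsUnit w) (ha : a ∈ maximalIdeal S) : IsUnit (w + a) := by
  by_contra h
  have hmem : w + a ∈ maximalIdeal S := (IsLocalRing.mem_maximalIdeal _).mpr h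
  have := Ideal.sub_mem _ hmem ha
  rw [add_sub_cancel_right] at this
  exact (IsLocalRing.mem_maximalIdeal _).mp this hw

/-- **Shape of a chord/tangent sum of slope `λ ∈ 𝔪`.** In the situation of
`add_eq_of_slope_eq` with `λ ∈ 𝔪`, `w ∈ Rˣ` and `1 ≤ m`: if `2m < n` the sum `P₁ + P₂` is a
low point of level `m` and branch `0`, `(πᵐu, πᵐut)` with `u ∈ Rˣ`, `t ∈ 𝔪` (here
`u = x₃ ≡ w²/e` is a unit and `u(t + 1) = −(λu + w)` is a unit, so `t ∉ −1 + 𝔪` and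
`LocalIndex.shape_of_bad` leaves `t ∈ 𝔪`); if `2m = n` it is a middle point `(πᵐx', πᵐy')`,
`y' ∈ Rˣ`. This is the additivity of `v(u)` on Tate's `K*/q^ℤ` (Silverman, *ATAEC*, V.4,
Lemma 4.1.2: `v(x) = min(v(u), v(q) − v(u))`), proved on the equation.
[cite: SilvermanATAEC1994, V.4 Lemma 4.1.2 (PDF p. 403)] -/
theorem shape_add_of_slope_eq (hϖ : Irreducible ϖ) (h1 : J.a₁ = 1) (h2 : J.a₂ = 0)
    (h3 : J.a₃ = 0) (h4 : J.a₄ = 0) (hα : IsUnit α) (h6 : J.a₆ = α * ϖ ^ n)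
    {x₁ y₁ x₂ y₂ ℓ w e : R} {m : ℕ} (hm : 1 ≤ m) (h2m : 2 * m ≤ n)
    (hℓ : ℓ ∈ maximalIdeal R) (hw : IsUnit w) (he : IsUnit e)
    (hν : y₁ - ℓ * x₁ = ϖ ^ m * w) (hx : x₁ * x₂ = ϖ ^ m * e)
    (h₁ : (J.baseChange K).toAffine.Nonsingular (algebraMap R K x₁) (algebraMap R K y₁))
    (h₂ : (J.baseChange K).toAffine.Nonsingular (algebraMap R K x₂) (algebraMap R K y₂))
    (hxy : ¬(algebraMap R K x₁ = algebraMap R K x₂ ∧ algebraMap R K y₁ =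
      (J.baseChange K).toAffine.negY (algebraMap R K x₂) (algebraMap R K y₂)))
    (hslope : (J.baseChange K).toAffine.slope (algebraMap R K x₁) (algebraMap R K x₂)
      (algebraMap R K y₁) (algebraMap R K y₂) = algebraMap R K ℓ) :
    (2 * m < n → ∃ (u t : R) (h : (J.baseChange K).toAffine.Nonsingular
        (algebraMap R K (ϖ ^ m * u)) (algebraMap R K (ϖ ^ m * u * t))),
        IsUnit u ∧ t ∈ maximalIdeal R ∧
        WeierstrassCurve.Affine.Point.some _ _ h₁ + WeierstrassCurve.Affine.Point.some _ _ h₂ =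
          WeierstrassCurve.Affine.Point.some _ _ h) ∧
    (n = 2 * m → ∃ (x' y' : R) (h : (J.baseChange K).toAffine.Nonsingular
        (algebraMap R K (ϖ ^ m * x')) (algebraMap R K (ϖ ^ m * y'))),
        IsUnit y' ∧
        WeierstrassCurve.Affine.Point.some _ _ h₁ + WeierstrassCurve.Affine.Point.some _ _ h₂ =
          WeierstrassCurve.Affine.Point.some _ _ h) := by
  have hinj := IsFractionRing.injective R K
  have hϖ0 : ϖ ≠ 0 := hϖ.ne_zero
  have hm' : ϖ ∈ maximalIdeal R := (IsLocalRing.mem_maximalIdeal _).mpr hϖ.not_isUnit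
  obtain ⟨x₃, h, hex₃, hsum⟩ := add_eq_of_slope_eq J h1 h3 h6 hϖ0 h2m he hν hx h₁ h₂ hxy hslope
  have heq : J.toAffine.Equation (ϖ ^ m * x₃) (-(ϖ ^ m * (ℓ * x₃ + w + x₃))) :=
    (WeierstrassCurve.Affine.map_equation _ hinj _ _).mp h.left
  have hxm : ϖ ^ m * x₃ ∈ maximalIdeal R :=
    Ideal.mul_mem_right _ _ (Ideal.pow_mem_of_mem _ hm' m hm)
  have hshape := shape_of_bad J hϖ h1 h2 h3 h4 hα h6 hxm heq
  constructor
  · intro hlt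
    -- `x₃` is a unit
    have hx₃u : IsUnit x₃ := by
      have hu : IsUnit (e * x₃) := by
        rw [hex₃]
        obtain ⟨d, hd⟩ : ∃ d, n - 2 * m = d + 1 := ⟨n - 2 * m - 1, by omega⟩
        rw [hd, sub_eq_add_neg]
        refine isUnit_add_of_isUnit_of_mem (hw.pow 2) ((Ideal.neg_mem_iff _).mpr ?_)
        rw [pow_succ]
        exact Ideal.mul_mem_left _ _ (Ideal.mul_mem_left _ _ hm')
      exact isUnit_of_mul_isUnit_right hu
    rcases hshape with ⟨i, u, t, -, -, hu, hxe, hye, ht⟩ | ⟨hh, x', y', hnh, -, hxe, -⟩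
    · have hcmp : ↑hx₃u.unit * ϖ ^ m = ↑hu.unit * ϖ ^ i := by
        rw [hx₃u.unit_spec, hu.unit_spec, mul_comm, hxe, mul_comm]
      obtain rfl : m = i := IsDiscreteValuationRing.unit_mul_pow_congr_pow hϖ hϖ _ _ _ _ hcmp
      have hux : x₃ = u := by
        have h' := IsDiscreteValuationRing.unit_mul_pow_congr_unit hϖ _ _ _ _ hcmp
        rw [← hx₃u.unit_spec, ← hu.unit_spec, h']
      have ht0 : t ∈ maximalIdeal R := by
        rcases ht with ht | ht1
        · exact ht
        · exfalso
          have e1 : ϖ ^ m * (x₃ * (t + 1)) = ϖ ^ m * (-(ℓ * x₃ + w)) := by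
            rw [hux] at hye ⊢; linear_combination -hye
          have e2 := mul_left_cancel₀ (pow_ne_zero m hϖ0) e1
          have hunit : IsUnit (-(ℓ * x₃ + w)) := by
            rw [IsUnit.neg_iff, add_comm]
            exact isUnit_add_of_isUnit_of_mem hw (Ideal.mul_mem_right _ _ hℓ)
          have hmem : x₃ * (t + 1) ∈ maximalIdeal R := Ideal.mul_mem_left _ _ ht1
          rw [e2] at hmem
          exact (IsLocalRing.mem_maximalIdeal _).mp hmem hunit
      refine ⟨u, t, ?_, hu, ht0, ?_⟩
      · rw [← hye, ← hxe]; exact h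
      · rw [hsum]; exact point_some_congr (congrArg _ hxe) (congrArg _ hye)
    · exfalso
      have hdvd : ϖ ^ hh ∣ ϖ ^ m * x₃ := ⟨x', hxe⟩
      rw [hx₃u.dvd_mul_right] at hdvd
      have := (pow_dvd_pow_iff hϖ0 hϖ.not_isUnit).mp hdvd
      omega
  · intro hneq
    rcases hshape with ⟨i, u, t, -, h2i, hu, hxe, -, -⟩ | ⟨hh, x', y', hnh, hy', hxe, hye⟩
    · exfalso
      have hdvd : ϖ ^ m ∣ ϖ ^ i * u := ⟨x₃, hxe.symm⟩
      rw [hu.dvd_mul_right] at hdvd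
      have := (pow_dvd_pow_iff hϖ0 hϖ.not_isUnit).mp hdvd
      omega
    · obtain rfl : hh = m := by omega
      refine ⟨x', y', ?_, hy', ?_⟩
      · rw [← hye, ← hxe]; exact h
      · rw [hsum]; exact point_some_congr (congrArg _ hxe) (congrArg _ hye)

end TateNormalForm

end LocalIndex

end Literature.NumberTheory.EllipticCurves

end
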